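import Summits.BirchSwinnertonDyer.Rank1Residual.X2.LambdaParity
import Summits.BirchSwinnertonDyer.Rank1Residual.X1.ParitySqueeze
import Summits.BirchSwinnertonDyer.BirchSwinnertonDyer.Theorems.EisensteinPrimesMazurTwinFamily
import Literature.NumberTheory.EllipticCurves.LFunctionPrimeCoeffMultiplicative
import Literature.NumberTheory.EllipticCurves.ManinConstantQuadraticTwistClassCertificate
import Literature.NumberTheory.EllipticCurves.GreenbergVatsal2000.NonPrimitiveSelmerGroup
import HarnessLib

/-!
# Route `EisensteinPrimes`, line `mudescent`, stub `stub_lambdaCount_offLocus` (cruxes 3 / 5), ANALYTIC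
# half: the PARITY LEMMA `λ_an ≡ 1 + #{split ℓ ∣ N, ℓ ≠ p} (mod 2)` is a THEOREM for every semistable
# curve (helper file; closes nothing)

Seat `bsd-eis-lam-a` g13 (PROGRAMME PART 1b, ACCEL-LIST (4); CONSTRUCTION seat, open-problem grade),
items stmt-BirchSwinnertonDyer-19033 (crux 3 `MazurMCOnCellB`, X2 currency: odd multiplicative
Eisenstein prime; skeleton `Cruxes/MazurMCOnCellB/Lines/mudescent.lean` bcae135b, LEAD `bsd-line-x2-p1`
holds the ALGEBRAIC half of stub 4, this seat the analytic half) and -19035 (crux 5, X1 currency).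
HONEST FRAMING (cell `bsd-eis`, programme §HONESTY: no tranche here proves BSD). THEOREMS ONLY — no
definition, no new named fact, nothing asserted about any particular curve, closes nothing; no label
or count of record moves; the class-wide content of stub 4 stays OPEN.

WHAT THIS FILE PROVES. The cell's C^rel instrument (lam-a MEMO-10 §3c, MEMO-12 §3) READ the `(μ, λ)`
of the `p`-adic `L`-function of 6 651 + 696 type-A étale ends at `p = 3, 5` with the pre-registered
KILL CRITERION «PARITY LEMMA» `λ_an ≡ 1 + #{ℓ ∣ N split, ℓ ≠ p} (mod 2)` (kept 5 305/5 305 @3,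
286/286 @5); the same congruence is the «`X` odd» step of THEOREM C^mix's order clause (MEMO-11 §3b,
MEMO-12 §1). Here it becomes a kernel theorem for EVERY elliptic `W / ℚ` with SQUAREFREE conductor
(no Eisenstein / type-A / torsion hypothesis): §1 **the sign of a semistable curve**,
`(−1)^{r_an} = −∏_{q ∣ N}(−a_q(W))` (`neg_one_pow_analyticRank_eq_neg_prod`), i.e.
`r_an ≡ 1 + #{split q ∣ N}` (`even_analyticRank_iff_odd_card_split`) — the tree's Fricke/Atkin–Lehner
calculus (`IsNewform0.frickeEigenvalue_eq_prod_atkinLehnerEigenvalueAt_holds` = Knapp 9.27(c),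
`IsNewform0.atkinLehnerEigenvalueAt_eq_neg_coeff_of_not_dvd` = Atkin–Lehner Thm. 3 at `q ∥ N`,
`atkinLehnerMainLemma0_holds`), Hecke's functional equation transported to `E`
(`hasFunctionalEquationSign_of_isNewformOf`, `neg_one_pow_analyticRank_eq_of_hasFunctionalEquationSign`)
and `a_q = ±1` at split / non-split primes (`LFunction_apply_prime_of_…`); modularity is a
HYPOTHESIS (`IsNewformOf W f` at level `N_W` / the route's `nonempty_modularParametrizationData`);
§3–§4 **the PARITY LEMMA**: with the tree's `p`-adic parities `λ_an ≡ r_an + [p split]` at `p ‖ N`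
(`X2.analyticLambdaEq_parity`) and `λ_an ≡ r_an` at good ordinary `p`
(`X1.LambdaParity.even_lam_iff_even_analyticRank`), for the TYPED data `X2.AnalyticMuLE ∧
X2.AnalyticLambdaEq W p n` (resp. `X1.ParitySqueeze.AnalyticLambdaEq W p n`) at a semistable pair
**`n + #splitPrimesOutside W p p` is ODD**, so is `n + Σ_{ℓ ∈ splitPrimesOutside W p p} s_ℓ`
(`s_ℓ = p^{·}` odd) — the class invariant `t = λ_an − Σ s_ℓ` of THEOREM A⁺ is ODD as a theorem, not a
reading — and the order-clause step «`X ≥ 0 ⇒ X ≥ 1`» (MEMO-12 §1/§8) follows (`…sum_sFactor_lt_of_le`).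

References: [Knapp1993] Thm. 9.27; [AtkinLehner1970] Thm. 3; [KellockDokchitser2023] Cor. 2.5
(`w(E) = (−1)^{1+s}`, `s` = number of split primes of a semistable `E`); [MazurTateTeitelbaum1986Invent]
§I.17–I.18; [GreenbergVatsal2000] §2 Prop. (2.4) (`s_ℓ`); HOME/lam-a-g12/lam-a-MEMO-12.md §3/§6.
-/

-- `Summit.BirchSwinnertonDyer.BirchSwinnertonDyer.…`: the summit and its single sub-problem share a
-- name (D-0017 layout), as in every `EisensteinPrimes*` Theorems file.
set_option linter.dupNamespace false
set_option autoImplicit false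

noncomputable section

open scoped Classical MatrixGroups ModularForm

open PowerSeries CongruenceSubgroup WeierstrassCurve Literature.NumberTheory.EllipticCurves
  Literature.NumberTheory.EllipticCurves.ModularForms
  Literature.NumberTheory.EllipticCurves.Rank1Residual
  Literature.NumberTheory.EllipticCurves.GreenbergVatsal2000
  Summit.BirchSwinnertonDyer.Rank1Residual
  Summit.BirchSwinnertonDyer.BirchSwinnertonDyer.Theorems.EisensteinPrimesMazurTwinFamily

namespace Summit.BirchSwinnertonDyer.BirchSwinnertonDyer.Theorems.EisensteinPrimesAnalyticLambdaParityLemma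

/-! ## §0. Two parity book-keeping lemmas -/
/-- A finite sum of ODD natural numbers has the parity of the number of summands. [folklore] -/
theorem even_sum_iff_even_card_of_forall_odd {ι : Type*} (S : Finset ι) (f : ι → ℕ)
    (hodd : ∀ i ∈ S, Odd (f i)) : (Even (∑ i ∈ S, f i) ↔ Even S.card) := by
  classical
  induction S using Finset.induction_on with
  | empty => simp
  | @insert a S haS ih =>
    rw [Finset.sum_insert haS, Finset.card_insert_of_notMem haS, Nat.even_add, Nat.even_add_one,
      ih (fun i hi ↦ hodd i (Finset.mem_insert_of_mem hi))]
    have ha : ¬ Even (f a) := Nat.not_even_iff_odd.mpr (hodd a (Finset.mem_insert_self a S))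
    tauto

/-- `s_ℓ = p^{v_p(ℓ^{p-1}-1)-1}` is odd for an odd prime `p`.
[cite: GreenbergVatsal2000, §2 Prop. (2.4) (p. 22)] -/
theorem odd_sFactor {p : ℕ} (hp : p.Prime) (hp2 : p ≠ 2) (ℓ : ℕ) : Odd (sFactor p ℓ) := by
  unfold sFactor
  exact (hp.odd_of_ne_two hp2).pow

/-! ## §1. The sign of the functional equation of a SEMISTABLE curve -/

section Semistable
variable (W : WeierstrassCurve ℚ) [W.IsElliptic]

/-- **Every prime of a squarefree conductor is a prime of multiplicative reduction** (`q ∣ N_W`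
is bad, `q² ∤ N_W` is not additive; Silverman ATAEC IV.10.2(c), tree
`hasGoodReductionAtPrime_or_hasMultiplicativeReductionAtPrime_of_not_sq_dvd_conductorNorm`,
`dvd_conductorNorm_iff_not_hasGoodReductionAtPrime`). [cite: Silverman1994, IV.10.2(c)] -/
theorem hasMultiplicativeReductionAtPrime_of_dvd_of_squarefree
    (hsq : Squarefree (W.conductorNorm ℤ)) (q : ℕ) [Fact q.Prime] (hq : q ∣ W.conductorNorm ℤ) :
    W.HasMultiplicativeReductionAtPrime q := by
  have hq2 : ¬ q ^ 2 ∣ W.conductorNorm ℤ := fun h ↦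
    (Fact.out : q.Prime).ne_one (Nat.isUnit_iff.mp (hsq q (by rwa [pow_two] at h)))
  rcases hasGoodReductionAtPrime_or_hasMultiplicativeReductionAtPrime_of_not_sq_dvd_conductorNorm
      (V := W) hq2 with hg | hm
  · exact absurd hg ((W.dvd_conductorNorm_iff_not_hasGoodReductionAtPrime q).mp hq)
  · exact hm

/-- **`a_q(W) = +1` at a split, `−1` at a non-split prime of a squarefree conductor** (Silverman
AEC Ex. 8.19(a) / §C.16; tree `LFunction_apply_prime_of_hasSplitMultiplicativeReductionAtPrime`,
`LFunction_apply_prime_of_hasMultiplicativeReductionAtPrime_of_not_split`).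
[cite: SilvermanAEC2009, Exercise 8.19(a) (p. 230) and §C.16 (PDF p. 390)] -/
theorem lFunction_apply_eq_ite_of_dvd_of_squarefree
    (hsq : Squarefree (W.conductorNorm ℤ)) (q : ℕ) [Fact q.Prime] (hq : q ∣ W.conductorNorm ℤ) :
    W.LFunction q = if W.HasSplitMultiplicativeReductionAtPrime q then 1 else -1 := by
  split_ifs with hs
  · exact W.LFunction_apply_prime_of_hasSplitMultiplicativeReductionAtPrime q hs
  · exact W.LFunction_apply_prime_of_hasMultiplicativeReductionAtPrime_of_not_split q
      (hasMultiplicativeReductionAtPrime_of_dvd_of_squarefree W hsq q hq) hs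

/-- **`(−1)^{r_an} = −∏_{q ∣ N}(−a_q(W))` for the newform of `W` at SQUAREFREE level `N = N_W`.**
`ε(f) = ∏_{q ∣ N} λ(Q_q)` (Knapp 9.27(c), `IsNewform0.frickeEigenvalue_eq_prod_atkinLehnerEigenvalueAt_holds`),
`λ(Q_q) = −a_q(f)` at `q ∥ N` (Atkin–Lehner Thm. 3, `IsNewform0.atkinLehnerEigenvalueAt_eq_neg_coeff_of_not_dvd`),
`a_q(f) = a_q(W)` (`IsNewformOf`), Hecke's sign is `w = −ε(f)` (`exists_frickeInvolution_eq_smul_of_mainLemma0`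
with `atkinLehnerMainLemma0_holds`, `exists_functional_equation_of_frickeInvolution_eq_smul`,
`hasFunctionalEquationSign_of_isNewformOf`) and `(−1)^{r_an} = w`
(`neg_one_pow_analyticRank_eq_of_hasFunctionalEquationSign`) — the complex-side bookkeeping of
`X2.exists_sign_eq_neg_one_pow_lam_mult`, run over ALL primes of the level instead of one.
[cite: Knapp1993, Thm. 9.27(c)] [cite: AtkinLehner1970, Thm. 3] [cite: KellockDokchitser2023, Cor. 2.5] -/
theorem neg_one_pow_analyticRank_eq_neg_prod {N : ℕ} [NeZero N] {f : CuspForm (Gamma0 N) 2}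
    (hN : N = W.conductorNorm ℤ) (hf : IsNewformOf W f) (hsq : Squarefree N) :
    (-1 : ℤ) ^ W.analyticRank = -∏ q ∈ N.primeFactors, -W.LFunction q := by
  have hf0 : f ≠ 0 := fun h0 ↦ hf.1.coe_ne_zero (by rw [h0]; rfl)
  have hprod : frickeEigenvalue f = ∏ q ∈ N.primeFactors, atkinLehnerEigenvalueAt f q :=
    IsNewform0.frickeEigenvalue_eq_prod_atkinLehnerEigenvalueAt_holds hf.1
  have hlam : ∀ q ∈ N.primeFactors, atkinLehnerEigenvalueAt f q = -((W.LFunction q : ℤ) : ℂ) := by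
    intro q hq
    have hqP : q.Prime := Nat.prime_of_mem_primeFactors hq
    haveI : Fact q.Prime := ⟨hqP⟩
    obtain ⟨M, hNM⟩ := Nat.dvd_of_mem_primeFactors hq
    have hqM : ¬ q ∣ M := fun ⟨M', hM'⟩ ↦
      hqP.ne_one (Nat.isUnit_iff.mp (hsq q ⟨M', by rw [hNM, hM']; ring⟩))
    rw [hf.1.atkinLehnerEigenvalueAt_eq_neg_coeff_of_not_dvd q hNM hqM, ← hf.2 q]
    rfl
  have hεprod : frickeEigenvalue f = ∏ q ∈ N.primeFactors, -((W.LFunction q : ℤ) : ℂ) :=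
    hprod.trans (Finset.prod_congr rfl hlam)
  obtain ⟨ε, -, hFr⟩ :=
    IsNewform0.exists_frickeInvolution_eq_smul_of_mainLemma0 N 2 (atkinLehnerMainLemma0_holds 2 N) hf.1
  have hεeq : ε = frickeEigenvalue f := by
    have h2 := frickeInvolution_eq_frickeEigenvalue_smul ⟨ε, hFr⟩
    rw [hFr] at h2
    have h3 : (ε - frickeEigenvalue f) • f = 0 := by rw [sub_smul, h2, sub_self]
    exact sub_eq_zero.mp ((smul_eq_zero.mp h3).resolve_right hf0)
  set w : ℤ := -∏ q ∈ N.primeFactors, -W.LFunction q with hw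
  have hwε : (w : ℂ) = -ε := by rw [hw, hεeq, hεprod]; push_cast; rfl
  have hE : W.HasEntireLFunction := hf.hasEntireLFunction
  obtain ⟨Λ, hΛ, hfe⟩ := exists_functional_equation_of_frickeInvolution_eq_smul
    (exists_completedCuspFormL_functional_equation_holds N 2) hFr
  subst hN
  have hC : (-1 : ℂ) ^ W.analyticRank = w :=
    neg_one_pow_analyticRank_eq_of_hasFunctionalEquationSign W hE
      (W.hasFunctionalEquationSign_of_isNewformOf hE hf hΛ hfe hwε)
  exact_mod_cast hC

/-- **`∏_{q ∣ N}(−a_q) = (−1)^{#split primes}` for a squarefree conductor**: `−a_q = −1` at a split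
and `+1` at a non-split prime. [cite: SilvermanAEC2009, §C.16 (definition of L_v(T)), PDF p. 390] -/
theorem prod_neg_lFunction_eq_neg_one_pow_card_split (hsq : Squarefree (W.conductorNorm ℤ)) :
    ∏ q ∈ (W.conductorNorm ℤ).primeFactors, -W.LFunction q =
      (-1) ^ ((W.conductorNorm ℤ).primeFactors.filter
        (fun ℓ ↦ ∃ hℓ : ℓ.Prime, @WeierstrassCurve.HasSplitMultiplicativeReductionAtPrime W ℓ ⟨hℓ⟩)).card := by
  set P : ℕ → Prop :=
    fun ℓ ↦ ∃ hℓ : ℓ.Prime, @WeierstrassCurve.HasSplitMultiplicativeReductionAtPrime W ℓ ⟨hℓ⟩ with hP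
  have hite : ∀ q ∈ (W.conductorNorm ℤ).primeFactors,
      -W.LFunction q = if P q then (-1 : ℤ) else 1 := by
    intro q hq
    have hqP : q.Prime := Nat.prime_of_mem_primeFactors hq
    haveI : Fact q.Prime := ⟨hqP⟩
    have hqN : q ∣ W.conductorNorm ℤ := Nat.dvd_of_mem_primeFactors hq
    have hPq : P q ↔ W.HasSplitMultiplicativeReductionAtPrime q :=
      ⟨fun ⟨_, h⟩ ↦ h, fun h ↦ ⟨hqP, h⟩⟩
    rw [lFunction_apply_eq_ite_of_dvd_of_squarefree W hsq q hqN]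
    by_cases hs : W.HasSplitMultiplicativeReductionAtPrime q
    · rw [if_pos hs, if_pos (hPq.mpr hs)]
    · rw [if_neg hs, if_neg (fun h ↦ hs (hPq.mp h)), neg_neg]
  rw [Finset.prod_congr rfl hite, Finset.prod_ite, Finset.prod_const, Finset.prod_const_one, mul_one]

/-- **`r_an ≡ 1 + #{split primes} (mod 2)` for a SEMISTABLE `E / ℚ`** (Kellock–Dokchitser 2023
Cor. 2.5 `w(E) = (−1)^{1+s}`, `s` = number of split primes, with the ANALYTIC sign `(−1)^{r_an}`): for
the newform `f` of `W` at level `N_W`, squarefree, `r_an` is even iff the number of split multiplicative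
primes is odd. [cite: KellockDokchitser2023, Cor. 2.5] [cite: Knapp1993, Thm. 9.27(c)] -/
theorem even_analyticRank_iff_odd_card_split [NeZero (W.conductorNorm ℤ)]
    {f : CuspForm (Gamma0 (W.conductorNorm ℤ)) 2} (hf : IsNewformOf W f)
    (hsq : Squarefree (W.conductorNorm ℤ)) :
    Even W.analyticRank ↔ Odd ((W.conductorNorm ℤ).primeFactors.filter
      (fun ℓ ↦ ∃ hℓ : ℓ.Prime, @WeierstrassCurve.HasSplitMultiplicativeReductionAtPrime W ℓ ⟨hℓ⟩)).card := by
  have h := neg_one_pow_analyticRank_eq_neg_prod W rfl hf hsq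
  rw [prod_neg_lFunction_eq_neg_one_pow_card_split W hsq] at h
  set s := ((W.conductorNorm ℤ).primeFactors.filter
      (fun ℓ ↦ ∃ hℓ : ℓ.Prime, @WeierstrassCurve.HasSplitMultiplicativeReductionAtPrime W ℓ ⟨hℓ⟩)).card
  rcases Nat.even_or_odd W.analyticRank with hr | hr <;> rcases Nat.even_or_odd s with hs | hs
  · rw [hr.neg_one_pow, hs.neg_one_pow] at h; norm_num at h
  · exact ⟨fun _ ↦ hs, fun _ ↦ hr⟩
  · exact ⟨fun h' ↦ absurd h' (Nat.not_even_iff_odd.mpr hr), fun h' ↦ absurd hs (Nat.not_even_iff_odd.mpr h')⟩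
  · rw [hr.neg_one_pow, hs.neg_one_pow] at h; norm_num at h

end Semistable

/-! ## §2. Book-keeping: `splitPrimesOutside W p p` is the set of split primes other than `p` -/

section Bookkeeping
variable (W : WeierstrassCurve ℚ) [W.IsElliptic] [W.IsGloballyMinimal] (p : ℕ) [Fact p.Prime]

omit [Fact p.Prime] in
/-- lam-a's raising set `splitPrimesOutside W p p` (p589499, `MazurTwinFamily`) is the set of split
multiplicative primes of `N_W` with `p` removed. [cite: GreenbergVatsal2000, §1 (9)–(10)] -/
theorem splitPrimesOutside_self_eq_erase :
    splitPrimesOutside W p p = ((W.conductorNorm ℤ).primeFactors.filter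
      (fun ℓ ↦ ∃ hℓ : ℓ.Prime, @WeierstrassCurve.HasSplitMultiplicativeReductionAtPrime W ℓ ⟨hℓ⟩)).erase p := by
  ext ℓ
  rw [mem_splitPrimesOutside, Finset.mem_erase, Finset.mem_filter, Nat.mem_primeFactors]
  constructor
  · rintro ⟨hdvd, hN0, hne, -, hℓ, hs⟩
    exact ⟨hne, ⟨hℓ, hdvd, hN0⟩, hℓ, hs⟩
  · rintro ⟨hne, ⟨hℓ, hdvd, hN0⟩, hℓ', hs⟩
    exact ⟨hdvd, hN0, hne, hne, hℓ', hs⟩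

/-- If `p` is not a split multiplicative prime of `N_W` (e.g. `p ∤ N_W`, or `p ‖ N_W` non-split),
`#splitPrimesOutside W p p` is the number of split multiplicative primes.
[cite: GreenbergVatsal2000, §1 (9)–(10)] -/
theorem card_splitPrimesOutside_self_of_not_split
    (hns : p ∣ W.conductorNorm ℤ → ¬ W.HasSplitMultiplicativeReductionAtPrime p) :
    (splitPrimesOutside W p p).card = ((W.conductorNorm ℤ).primeFactors.filter
      (fun ℓ ↦ ∃ hℓ : ℓ.Prime, @WeierstrassCurve.HasSplitMultiplicativeReductionAtPrime W ℓ ⟨hℓ⟩)).card := by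
  rw [splitPrimesOutside_self_eq_erase, Finset.erase_eq_of_notMem]
  intro h
  obtain ⟨hp, hℓ, hs⟩ := Finset.mem_filter.mp h
  exact hns (Nat.dvd_of_mem_primeFactors hp) hs

/-- If `p ∣ N_W` IS split multiplicative, `#splitPrimesOutside W p p + 1` is the number of split
multiplicative primes. [cite: GreenbergVatsal2000, §1 (9)–(10)] -/
theorem card_splitPrimesOutside_self_add_one_of_split (hpN : p ∣ W.conductorNorm ℤ)
    (hs : W.HasSplitMultiplicativeReductionAtPrime p) :
    (splitPrimesOutside W p p).card + 1 = ((W.conductorNorm ℤ).primeFactors.filter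
      (fun ℓ ↦ ∃ hℓ : ℓ.Prime, @WeierstrassCurve.HasSplitMultiplicativeReductionAtPrime W ℓ ⟨hℓ⟩)).card := by
  rw [splitPrimesOutside_self_eq_erase]
  apply Finset.card_erase_add_one
  rw [Finset.mem_filter, Nat.mem_primeFactors]
  exact ⟨⟨Fact.out, hpN, (W.conductorNorm_pos_holds).ne'⟩, Fact.out, hs⟩

end Bookkeeping

/-! ## §3. THE PARITY LEMMA at an odd multiplicative Eisenstein prime (X2 currency, crux 3) -/

section X2

variable (W : WeierstrassCurve ℚ) [W.IsElliptic] [W.IsGloballyMinimal] (p : ℕ) [Fact p.Prime]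

/-- **PARITY LEMMA (X2).** `W / ℚ` globally minimal with SQUAREFREE conductor, `p ≠ 2` of
multiplicative reduction with `E[p]` reducible, and a certified pair `μ_an ≤ m`, `λ_an = n`
(`X2.AnalyticMuLE W p m`, `X2.AnalyticLambdaEq W p n` — THE Mazur–Tate–Teitelbaum `p`-adic
`L`-function, Néron-normalised, trivial zero included). Then
**`n + #{ℓ ∣ N split multiplicative, ℓ ≠ p}` is ODD**, i.e. `λ_an ≡ 1 + #splitPrimesOutside W p p
(mod 2)`: `n + r_an ≡ e` (`X2.analyticLambdaEq_parity`, `e = [p split]`), `r_an ≡ 1 + #split`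
(`even_analyticRank_iff_odd_card_split`), `#split = #splitPrimesOutside W p p + e`. PUBLISHED inputs
as hypotheses, those of `X2.analyticLambdaEq_parity` (Wuthrich Thm. 16 `hWu`, modularity `hpar`).
The instrument's pre-registered kill criterion (MEMO-12 §3: 5 305/5 305 @3) as a theorem.
[cite: MazurTateTeitelbaum1986Invent, §I.17–I.18] [cite: Wuthrich2014, Thm. 16 (p. 397)] -/
theorem X2.odd_analyticLambda_add_card_splitPrimesOutside
    (hWu : Wuthrich2014.thm16_charIdeal_dvd_multiplicative_of_reducible)
    (hpar : nonempty_modularParametrizationData)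
    (hsq : Squarefree (W.conductorNorm ℤ)) (hp2 : p ≠ 2)
    (hmult : W.HasMultiplicativeReductionAtPrime p) (hred : ¬ W.HasIrreducibleModPGaloisRep p)
    {n m : ℕ} (hμ : X2.AnalyticMuLE W p m) (hlam : X2.AnalyticLambdaEq W p n) :
    Odd (n + (splitPrimesOutside W p p).card) := by
  haveI : NeZero (W.conductorNorm ℤ) := ⟨(W.conductorNorm_pos_holds).ne'⟩
  obtain ⟨Dm⟩ := hpar W
  have hf : IsNewformOf W Dm.f := Dm.isNewformOf
  have hr := even_analyticRank_iff_odd_card_split W hf hsq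
  obtain ⟨hn_ns, hn_s⟩ := X2.analyticLambdaEq_parity hWu hpar W p hp2 hmult hred hμ hlam
  by_cases hsplit : W.HasSplitMultiplicativeReductionAtPrime p
  · have hpN : p ∣ W.conductorNorm ℤ := hf.dvd_level_of_split hsplit
    have hcard := card_splitPrimesOutside_self_add_one_of_split W p hpN hsplit
    rw [← hcard] at hr
    have h1 : Odd (n + W.analyticRank) := hn_s hsplit
    rw [Nat.odd_add] at h1 ⊢
    rw [h1, hr, Nat.odd_add_one, Nat.not_odd_iff_even]
  · have hcard := card_splitPrimesOutside_self_of_not_split W p (fun _ ↦ hsplit)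
    rw [← hcard] at hr
    have h1 : Even (n + W.analyticRank) := hn_ns hsplit
    rw [Nat.even_add] at h1
    rw [Nat.odd_add, ← Nat.not_even_iff_odd, h1, hr, Nat.not_odd_iff_even]

/-- **PARITY LEMMA (X2), `s_ℓ`-form: `t = λ_an − Σ_{split ℓ ≠ p} s_ℓ` is ODD** (the class invariant
of lam-a's THEOREM A⁺; MEMO-12 §6 «t is ODD on all 6 160 classes read» is a theorem wherever a
certificate exists): `n + Σ_{ℓ ∈ splitPrimesOutside W p p} s_ℓ` is odd, `s_ℓ = p^{·}` being odd.
[cite: GreenbergVatsal2000, §2 Prop. (2.4) (p. 22)] [cite: MazurTateTeitelbaum1986Invent, §I.17–I.18] -/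
theorem X2.odd_analyticLambda_add_sum_sFactor
    (hWu : Wuthrich2014.thm16_charIdeal_dvd_multiplicative_of_reducible)
    (hpar : nonempty_modularParametrizationData)
    (hsq : Squarefree (W.conductorNorm ℤ)) (hp2 : p ≠ 2)
    (hmult : W.HasMultiplicativeReductionAtPrime p) (hred : ¬ W.HasIrreducibleModPGaloisRep p)
    {n m : ℕ} (hμ : X2.AnalyticMuLE W p m) (hlam : X2.AnalyticLambdaEq W p n) :
    Odd (n + ∑ ℓ ∈ splitPrimesOutside W p p, sFactor p ℓ) := by
  have h := X2.odd_analyticLambda_add_card_splitPrimesOutside W p hWu hpar hsq hp2 hmult hred hμ hlam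
  have hs : Even (∑ ℓ ∈ splitPrimesOutside W p p, sFactor p ℓ) ↔
      Even (splitPrimesOutside W p p).card :=
    even_sum_iff_even_card_of_forall_odd _ _ (fun ℓ _ ↦ odd_sFactor Fact.out hp2 ℓ)
  rw [Nat.odd_add] at h ⊢
  rw [hs, h]

/-- **The order-clause step «`X ≥ 0 ⇒ X ≥ 1`» (lam-a MEMO-12 §1/§8) is a theorem**: at a semistable
X2 pair a certified `λ_an = n ≥ Σ_{split ℓ ≠ p} s_ℓ` exceeds it (`n − Σ s_ℓ` is odd, hence non-zero).
[cite: GreenbergVatsal2000, §2 Prop. (2.4) (p. 22)] -/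
theorem X2.sum_sFactor_lt_of_le
    (hWu : Wuthrich2014.thm16_charIdeal_dvd_multiplicative_of_reducible)
    (hpar : nonempty_modularParametrizationData)
    (hsq : Squarefree (W.conductorNorm ℤ)) (hp2 : p ≠ 2)
    (hmult : W.HasMultiplicativeReductionAtPrime p) (hred : ¬ W.HasIrreducibleModPGaloisRep p)
    {n m : ℕ} (hμ : X2.AnalyticMuLE W p m) (hlam : X2.AnalyticLambdaEq W p n)
    (hle : ∑ ℓ ∈ splitPrimesOutside W p p, sFactor p ℓ ≤ n) :
    ∑ ℓ ∈ splitPrimesOutside W p p, sFactor p ℓ < n := by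
  refine hle.lt_or_eq.elim id fun heq ↦ absurd
    (X2.odd_analyticLambda_add_sum_sFactor W p hWu hpar hsq hp2 hmult hred hμ hlam) ?_
  rw [← heq, ← two_mul]
  exact Nat.not_odd_iff_even.mpr (even_two_mul _)

end X2

/-! ## §4. THE PARITY LEMMA at a good ordinary Eisenstein prime (X1 currency, crux 5 and row A1) -/

section X1

open Summit.BirchSwinnertonDyer.Rank1Residual.X1.MuLambda

variable (W : WeierstrassCurve ℚ) [W.IsElliptic] [W.IsGloballyMinimal] (p : ℕ) [Fact p.Prime]

/-- **PARITY LEMMA (X1).** `W / ℚ` globally minimal with SQUAREFREE conductor, `p ≠ 2` good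
ordinary with `E[p]` reducible, a certified `λ_an = n` (`X1.ParitySqueeze.AnalyticLambdaEq W p n`, the
Mazur–Swinnerton-Dyer `L_p` at the unit root, Néron-normalised): **`n + #{ℓ ∣ N split}` is ODD** —
`n ≡ r_an` (`X1.LambdaParity.even_lam_iff_even_analyticRank` on the integral `g`, `ι(g) = ϖ·L_p`, of
Wuthrich's divisibility `hW16`), `r_an ≡ 1 + #split` (§1), `p ∤ N`. PUBLISHED inputs as hypotheses,
those of `X1.ParitySqueeze.Leaf.even_of_analyticLambdaEq` (`hW16`, modularity `hmod`); on row A1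
(`r_an = 1`; the instrument's 6 160 classes @3) it reads `λ_an ≡ 1 + #split (mod 2)`.
[cite: MazurTateTeitelbaum1986Invent, §I.17–I.18] [cite: Wuthrich2014, Thm. 16 (p. 397)] -/
theorem X1.odd_analyticLambda_add_card_splitPrimesOutside
    (hW16 : Wuthrich2014.charIdeal_dvd_padicLFunction) (hmod : nonempty_modularParametrizationData)
    (hsq : Squarefree (W.conductorNorm ℤ)) (hp2 : p ≠ 2) (hord : IsOrdinaryAt W p)
    (hred : ¬ W.HasIrreducibleModPGaloisRep p) {n : ℕ}
    (hn : X1.ParitySqueeze.AnalyticLambdaEq W p n) :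
    Odd (n + (splitPrimesOutside W p p).card) := by
  haveI : NeZero (W.conductorNorm ℤ) := ⟨(W.conductorNorm_pos_holds).ne'⟩
  obtain ⟨Dm⟩ := hmod W
  have hf : IsNewformOf W Dm.f := Dm.isNewformOf
  obtain ⟨ϖ, hϖpos, hϖeq, -⟩ := Dm.exists_rat_mul_realPeriodRat_eq_plusPeriod
  obtain ⟨κ, hκ, γ, hγ, hγ'⟩ := exists_isCyclotomic_isTopGenerator_isCyclotomicVariable_holds p
  obtain ⟨D⟩ := W.nonempty_selmerDualData_holds κ γ hγ
  obtain ⟨-, g, -, hιg⟩ := hW16 W p hp2 hord hred hκ hγ hγ' hf D ϖ hϖeq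
  have hlam : lam g = n := hn Dm.f hf ϖ hϖeq g hιg
  have hpar : Even (lam g) ↔ Even W.analyticRank :=
    X1.LambdaParity.even_lam_iff_even_analyticRank W p hp2 hf hord (by exact_mod_cast hϖpos.ne') hιg
  rw [hlam] at hpar
  have hr := even_analyticRank_iff_odd_card_split W hf hsq
  have hpN : ¬ p ∣ W.conductorNorm ℤ := fun h ↦
    (W.dvd_conductorNorm_iff_not_hasGoodReductionAtPrime p).mp h hord.1
  rw [← card_splitPrimesOutside_self_of_not_split W p (fun h ↦ absurd h hpN)] at hr
  rw [Nat.odd_add, ← Nat.not_even_iff_odd, hpar, hr, Nat.not_odd_iff_even]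

/-- **PARITY LEMMA (X1), `s_ℓ`-form: `n + Σ_{split ℓ} s_ℓ` is odd** (the class invariant
`t = λ_an − Σ s_ℓ` is ODD). Same hypotheses as `X1.odd_analyticLambda_add_card_splitPrimesOutside`.
[cite: GreenbergVatsal2000, §2 Prop. (2.4) (p. 22)] [cite: MazurTateTeitelbaum1986Invent, §I.17–I.18] -/
theorem X1.odd_analyticLambda_add_sum_sFactor
    (hW16 : Wuthrich2014.charIdeal_dvd_padicLFunction) (hmod : nonempty_modularParametrizationData)
    (hsq : Squarefree (W.conductorNorm ℤ)) (hp2 : p ≠ 2) (hord : IsOrdinaryAt W p)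
    (hred : ¬ W.HasIrreducibleModPGaloisRep p) {n : ℕ}
    (hn : X1.ParitySqueeze.AnalyticLambdaEq W p n) :
    Odd (n + ∑ ℓ ∈ splitPrimesOutside W p p, sFactor p ℓ) := by
  have h := X1.odd_analyticLambda_add_card_splitPrimesOutside W p hW16 hmod hsq hp2 hord hred hn
  have hs : Even (∑ ℓ ∈ splitPrimesOutside W p p, sFactor p ℓ) ↔
      Even (splitPrimesOutside W p p).card :=
    even_sum_iff_even_card_of_forall_odd _ _ (fun ℓ _ ↦ odd_sFactor Fact.out hp2 ℓ)
  rw [Nat.odd_add] at h ⊢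
  rw [hs, h]

/-- **«`X ≥ 0 ⇒ X ≥ 1`» at a good ordinary Eisenstein prime**: at a semistable X1 pair, a
certified `λ_an = n ≥ Σ_{split ℓ} s_ℓ` forces `λ_an > Σ s_ℓ`. [cite: GreenbergVatsal2000, §2 Prop. (2.4) (p. 22)] -/
theorem X1.sum_sFactor_lt_of_le
    (hW16 : Wuthrich2014.charIdeal_dvd_padicLFunction) (hmod : nonempty_modularParametrizationData)
    (hsq : Squarefree (W.conductorNorm ℤ)) (hp2 : p ≠ 2) (hord : IsOrdinaryAt W p)
    (hred : ¬ W.HasIrreducibleModPGaloisRep p) {n : ℕ}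
    (hn : X1.ParitySqueeze.AnalyticLambdaEq W p n)
    (hle : ∑ ℓ ∈ splitPrimesOutside W p p, sFactor p ℓ ≤ n) :
    ∑ ℓ ∈ splitPrimesOutside W p p, sFactor p ℓ < n := by
  refine hle.lt_or_eq.elim id fun heq ↦ absurd
    (X1.odd_analyticLambda_add_sum_sFactor W p hW16 hmod hsq hp2 hord hred hn) ?_
  rw [← heq, ← two_mul]
  exact Nat.not_odd_iff_even.mpr (even_two_mul _)

end X1

end Summit.BirchSwinnertonDyer.BirchSwinnertonDyer.Theorems.EisensteinPrimesAnalyticLambdaParityLemma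

end
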